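import Literature.NumberTheory.Sieve.UnitPeriodizedCube
import Literature.Algebra.EuclideanLattices.PeriodizeSmooth
import HarnessLib

/-!
# The smooth character sums `Θ_{Ω'}(χ)` over the units: cosets of `U_𝔣` and the characters `λ_k`

Topic `Literature/NumberTheory/Sieve`, sub-namespace `ThetaUnits`. Third brick of the harmonic
analysis of `Θ_{Ω'}(χ) = ∑_{α prime} Ω'(α) χ(α)` (`SmoothSmallModuli.theta`) on the unit torus of
a totally real field (Mitsui 1956 §3, Hecke 1920 §1). For a fixed totally positive `ω₀ ≠ 0` the
sum of `Ω'(ηω₀)χ(ηω₀)` over ALL totally positive units `η ∈ U⁺` splits along the cosets of the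
finite-index subgroup `U_𝔣 = kerPosUnits χ` (`UnitKernelLattice`); on each coset `χ` is constant and
the weights add up to the periodization of `UnitPeriodizedCube`:

* `weightΩfam_eq_Wcube'` — the family weight is the cube log-weight of `logVec α` for EVERY `α`;
* `lam χ k x = e_k(h(x))` — the characters `λ_k` of `K^× → logSpace K / L_𝔣` (`echar` of
  `LatticePeriodicFunctions` at the trace-zero coordinate of `logVec x`): multiplicative, of norm `1`,
  trivial on `U_𝔣`;
* `posUnitsProdEquiv` — `U⁺ ≃ (U⁺/U_𝔣) × U_𝔣`, `(q, η) ↦ q.out η`;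
* **`tsum_posUnits_eq_sum_cosets`** —
  `∑'_{η ∈ U⁺} Ω'(ηω₀) χ(ηω₀) = ∑_{q ∈ U⁺/U_𝔣} χ(r_q ω₀) · periodize L_𝔣 (Φ_t) (h(r_q ω₀))`.

## References

* T. Mitsui, Jap. J. Math. 26 (1956), §3. [cite: Mitsui1956, §3]
* E. Hecke, Math. Z. 6 (1920), §1. [cite: HeckeMathZ1920, §1]
-/

noncomputable section

open NumberField NumberField.InfinitePlace NumberField.Units NumberField.Units.dirichletUnitTheorem
  Literature.NumberTheory.LFunctions Literature.NumberTheory.LFunctions.HeckeCone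
  Literature.NumberTheory.LFunctions.AbelianDensity
  Literature.NumberTheory.Sieve.UnitKernel Literature.NumberTheory.Sieve.UnitPeriodic
  Literature.Algebra.EuclideanLattices.LatticePeriodic Module
  Literature.NumberTheory.Sieve.NumberFieldLS Literature.NumberTheory.Sieve.SmoothTypeOne
  Literature.NumberTheory.Sieve.BoxPrimes
open scoped Classical

namespace Literature.NumberTheory.Sieve.ThetaUnits

variable {K : Type*} [Field K] [NumberField K]

local notation "RP" => {w : InfinitePlace K // IsReal w}
local notation "rkE" => finrank ℝ (logSpace K)

/-! ## The family weight as a log-weight, unconditionally -/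

/-- **`weightΩfam kf M α = Wcube kf M (logVec α)`** for every `α` (the weight is defined in the
logarithmic coordinates `log σ_w α = log |σ_w α|`). [folklore] -/
theorem weightΩfam_eq_Wcube' [IsTotallyReal K] (kf : RP → ℝ → ℝ) (M : ℝ) (α : 𝓞 K) :
    weightΩfam K kf M α = (Wcube K kf M (logVec K (α : K)) : ℂ) := by
  unfold weightΩfam Wcube logVec
  rw [Complex.ofReal_prod]
  refine Finset.prod_congr rfl fun w _ => ?_
  rw [← abs_remb, Real.log_abs]

/-! ## The characters `λ_k` -/

variable {𝔣 : Ideal (𝓞 K)}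

/-- `λ_k(x) = e_k(h(x))`, `h(x)` the trace-zero coordinate of `logVec x`, `e_k` the characters of
`logSpace K / L_𝔣`. [cite: HeckeMathZ1920, §1] -/
def lam (χ : AddChar (Additive ((𝓞 K ⧸ 𝔣)ˣ)) ℂ) [IsZLattice ℝ (kerLattice χ)] (k : Fin rkE → ℤ) (x : K) : ℂ :=
  echar (kerLattice χ) k (toTH K (logVec K x)).2

variable (χ : AddChar (Additive ((𝓞 K ⧸ 𝔣)ˣ)) ℂ) [IsZLattice ℝ (kerLattice χ)]

omit [NumberField K] in
/-- A character of `E/L` is `1` on `L`. [folklore] -/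
theorem echar_of_mem {E : Type*} [NormedAddCommGroup E] [NormedSpace ℝ E] [FiniteDimensional ℝ E]
    (L : Submodule ℤ E) [DiscreteTopology L] [IsZLattice ℝ L] (k : Fin (finrank ℝ E) → ℤ) {ℓ : E} (hℓ : ℓ ∈ L) :
    echar L k ℓ = 1 := by
  have h := echar_add_of_mem L k hℓ 0
  rw [zero_add] at h
  rw [h]
  unfold echar
  simp

/-- **`λ_k` is multiplicative.** [folklore] -/
theorem lam_mul (k : Fin rkE → ℤ) {x y : K} (hx : x ≠ 0) (hy : y ≠ 0) : lam χ k (x * y) = lam χ k x * lam χ k y := by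
  unfold lam
  rw [logVec_mul hx hy, toTH_add, Prod.snd_add, echar_add]

/-- `‖λ_k(x)‖ = 1`. [folklore] -/
theorem norm_lam (k : Fin rkE → ℤ) (x : K) : ‖lam χ k x‖ = 1 := norm_echar _ _ _

/-- `λ_k(1) = 1`. [folklore] -/
theorem lam_one (k : Fin rkE → ℤ) : lam χ k 1 = 1 := by
  unfold lam
  have : logVec K (1 : K) = 0 := by funext w; simp [logVec]
  rw [this]
  have h0 : toTH K (0 : InfinitePlace K → ℝ) = 0 := by
    have h1 := toTH_add (K := K) 0 0
    rw [add_zero] at h1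
    have h2 : toTH K 0 + toTH K 0 = toTH K 0 + 0 := by rw [← h1, add_zero]
    exact add_left_cancel h2
  rw [h0, Prod.snd_zero]
  exact echar_of_mem _ k (Submodule.zero_mem _)

/-- **`λ_k = 1` on `U_𝔣`.** [cite: HeckeMathZ1920, §1] -/
theorem lam_unit_of_mem (k : Fin rkE → ℤ) {η : (𝓞 K)ˣ} (hη : η ∈ kerPosUnits χ) : lam χ k (((η : 𝓞 K) : K)) = 1 := by
  unfold lam
  rw [toTH_logVec_unit]
  exact echar_of_mem _ k (logEmbedding_mem_kerLattice hη)

/-! ## `U⁺ ≃ (U⁺/U_𝔣) × U_𝔣` -/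

omit [IsZLattice ℝ (kerLattice χ)] in
/-- `U_𝔣` as a subgroup of `U⁺`. [folklore] -/
abbrev Hsub : Subgroup (posUnits K) := (kerPosUnits χ).subgroupOf (posUnits K)

omit [IsZLattice ℝ (kerLattice χ)] in
/-- Membership in `Hsub`. [folklore] -/
theorem mem_Hsub {u : posUnits K} : u ∈ Hsub χ ↔ (u : (𝓞 K)ˣ) ∈ kerPosUnits χ := Subgroup.mem_subgroupOf

omit [IsZLattice ℝ (kerLattice χ)] in
/-- **`U⁺ ≃ (U⁺/U_𝔣) × U_𝔣`**, `(q, η) ↦ q.out · η`. [folklore] -/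
def posUnitsProdEquiv : (posUnits K ⧸ Hsub χ) × Hsub χ ≃ posUnits K where
  toFun p := p.1.out * (p.2 : posUnits K)
  invFun u := (QuotientGroup.mk u, ⟨(QuotientGroup.mk u : posUnits K ⧸ Hsub χ).out⁻¹ * u,
    by rw [← QuotientGroup.eq]; exact QuotientGroup.out_eq' _⟩)
  left_inv p := by
    obtain ⟨q, η⟩ := p
    have hq : (QuotientGroup.mk (q.out * (η : posUnits K)) : posUnits K ⧸ Hsub χ) = q := by
      rw [QuotientGroup.mk_mul_of_mem _ η.2, QuotientGroup.out_eq']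
    ext
    · exact hq
    · simp only
      rw [hq, ← mul_assoc, inv_mul_cancel, one_mul]
  right_inv u := by
    simp only
    rw [mul_inv_cancel_left]

omit [IsZLattice ℝ (kerLattice χ)] in
/-- The value of `posUnitsProdEquiv`. [folklore] -/
theorem posUnitsProdEquiv_apply (p : (posUnits K ⧸ Hsub χ) × Hsub χ) :
    (posUnitsProdEquiv χ p : posUnits K) = p.1.out * (p.2 : posUnits K) := rfl

/-! ## The unit sum along the cosets of `U_𝔣` -/

/-- The summand: `F(η) = Ω'(ηω₀) χ(ηω₀)` on the totally positive units. [folklore] -/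
def Fsum (kf : RP → ℝ → ℝ) (M : ℝ) (ω₀ : 𝓞 K) (η : posUnits K) : ℂ :=
  weightΩfam K kf M ((((η : posUnits K) : (𝓞 K)ˣ) : 𝓞 K) * ω₀) * unitValue χ (Ideal.Quotient.mk 𝔣 ((((η : posUnits K) : (𝓞 K)ˣ) : 𝓞 K) * ω₀))

omit [IsZLattice ℝ (kerLattice χ)] in
/-- The map `η ↦ ηω₀` (`ω₀ ≠ 0`) is injective on the units. [folklore] -/
theorem mul_injective {ω₀ : 𝓞 K} (hω₀ : ω₀ ≠ 0) :
    Function.Injective fun η : posUnits K => (((((η : posUnits K) : (𝓞 K)ˣ) : 𝓞 K) * ω₀ : 𝓞 K) : K) := by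
  intro η η' h
  simp only at h
  have h1 : ((((η : posUnits K) : (𝓞 K)ˣ) : 𝓞 K) : K) = ((((η' : posUnits K) : (𝓞 K)ˣ) : 𝓞 K) : K) := by
    push_cast at h
    exact mul_right_cancel₀ (by exact_mod_cast hω₀) h
  exact Subtype.ext (Units.ext (by exact_mod_cast h1))

/-- **Finite support**: for `M > 0` and profiles vanishing on `(0, ∞)`, `Ω'(ηω₀) ≠ 0` forces
`w(ηω₀) ≤ M` at every place, so only finitely many units contribute. [folklore] -/
theorem finite_support_weight [IsTotallyReal K] {kf : RP → ℝ → ℝ} (hhi : ∀ w v, 0 < v → kf w v = 0) {M : ℝ} (hM : 0 < M)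
    {ω₀ : 𝓞 K} (hω₀ : ω₀ ≠ 0) :
    {η : posUnits K | weightΩfam K kf M ((((η : posUnits K) : (𝓞 K)ˣ) : 𝓞 K) * ω₀) ≠ 0}.Finite := by
  have hfin := NumberField.Embeddings.finite_of_norm_le K ℂ M
  set f := fun η : posUnits K => (((((η : posUnits K) : (𝓞 K)ˣ) : 𝓞 K) * ω₀ : 𝓞 K) : K) with hf
  have hsub : {η : posUnits K | weightΩfam K kf M ((((η : posUnits K) : (𝓞 K)ˣ) : 𝓞 K) * ω₀) ≠ 0} ⊆
      f ⁻¹' {x : K | IsIntegral ℤ x ∧ ∀ φ : K →+* ℂ, ‖φ x‖ ≤ M} := by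
    intro η hη
    refine ⟨RingOfIntegers.isIntegral_coe _, fun φ => ?_⟩
    set α : 𝓞 K := (((η : posUnits K) : (𝓞 K)ˣ) : 𝓞 K) * ω₀ with hα
    have hα0 : (α : K) ≠ 0 := by
      rw [hα]; push_cast
      exact mul_ne_zero (by exact_mod_cast ((η : posUnits K) : (𝓞 K)ˣ).ne_zero) (by exact_mod_cast hω₀)
    set w : InfinitePlace K := InfinitePlace.mk φ with hw
    have hwr : IsReal w := IsTotallyReal.isReal w
    have hfac : kf ⟨w, hwr⟩ (Real.log (remb K (α : K) ⟨w, hwr⟩) - Real.log M) ≠ 0 := by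
      intro h0
      apply hη
      unfold weightΩfam
      exact Finset.prod_eq_zero (Finset.mem_univ (⟨w, hwr⟩ : RP)) (by rw [h0]; simp)
    have hle : Real.log (remb K (α : K) ⟨w, hwr⟩) - Real.log M ≤ 0 := by
      by_contra hlt; push Not at hlt; exact hfac (hhi _ _ hlt)
    have hwα : 0 < w (α : K) := InfinitePlace.pos_iff.2 hα0
    have hlogw : Real.log (w (α : K)) ≤ Real.log M := by
      rw [← Real.log_abs, abs_remb] at hle; linarith
    rw [show ‖φ (α : K)‖ = w (α : K) from rfl]
    exact (Real.log_le_log_iff hwα hM).1 hlogw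
  exact (hfin.preimage ((mul_injective hω₀).injOn)).subset hsub

omit [IsZLattice ℝ (kerLattice χ)] in
/-- The summand `F` has finite support (`M > 0`, profiles vanishing on `(0,∞)`). [folklore] -/
theorem finite_support_Fsum [IsTotallyReal K] {kf : RP → ℝ → ℝ} (hhi : ∀ w v, 0 < v → kf w v = 0) {M : ℝ} (hM : 0 < M)
    {ω₀ : 𝓞 K} (hω₀ : ω₀ ≠ 0) : (Function.support (Fsum χ kf M ω₀)).Finite := by
  refine (finite_support_weight hhi hM hω₀).subset fun η hη => ?_
  rw [Function.mem_support] at hη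
  intro h0
  exact hη (by unfold Fsum; rw [h0, zero_mul])

omit [IsZLattice ℝ (kerLattice χ)] in
/-- **`U_𝔣` has finite index in `U⁺`** (`𝔣 ≠ 0`): it contains the kernel of `U⁺ → (𝓞/𝔣)ˣ`.
[cite: Mitsui1956, §3] -/
theorem finiteIndex_Hsub (h𝔣 : 𝔣 ≠ ⊥) : (Hsub χ).FiniteIndex := by
  haveI : Finite (𝓞 K ⧸ 𝔣) := Ideal.finiteQuotientOfFreeOfNeBot 𝔣 h𝔣
  set ρ : posUnits K →* (𝓞 K ⧸ 𝔣)ˣ := (Units.map (Ideal.Quotient.mk 𝔣).toMonoidHom).comp (posUnits K).subtype with hρ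
  have hker : ρ.ker ≤ Hsub χ := by
    intro u hu
    rw [MonoidHom.mem_ker] at hu
    rw [mem_Hsub, mem_kerPosUnits]
    refine ⟨u.2, ?_⟩
    rw [unitChar_apply]
    have : Units.map (Ideal.Quotient.mk 𝔣).toMonoidHom (u : (𝓞 K)ˣ) = ρ u := rfl
    rw [this, hu, map_one]
  haveI : ρ.ker.FiniteIndex := by
    refine ⟨?_⟩
    rw [Subgroup.index_ker]
    exact Nat.card_pos.ne'
  exact Subgroup.finiteIndex_of_le hker

omit [IsZLattice ℝ (kerLattice χ)] in
/-- A `Fintype` structure on `U⁺/U_𝔣` (`𝔣 ≠ 0`). [folklore] -/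
@[reducible] def fintypeQuot (h𝔣 : 𝔣 ≠ ⊥) : Fintype (posUnits K ⧸ Hsub χ) :=
  haveI := finiteIndex_Hsub χ h𝔣
  Subgroup.fintypeQuotientOfFiniteIndex

omit [IsZLattice ℝ (kerLattice χ)] in
/-- On the coset `r_q · U_𝔣` the character is constant: `χ(η' r ω₀) = χ(r ω₀)` for `η' ∈ U_𝔣`. [folklore] -/
theorem unitValue_mul_of_mem {η' : (𝓞 K)ˣ} (hη' : η' ∈ kerPosUnits χ) (β : 𝓞 K) :
    unitValue χ (Ideal.Quotient.mk 𝔣 ((η' : 𝓞 K) * β)) = unitValue χ (Ideal.Quotient.mk 𝔣 β) := by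
  rw [map_mul, unitValue_mul]
  have h1 : (Ideal.Quotient.mk 𝔣 (η' : 𝓞 K)) = ((Units.map (Ideal.Quotient.mk 𝔣).toMonoidHom η' : (𝓞 K ⧸ 𝔣)ˣ) : 𝓞 K ⧸ 𝔣) := rfl
  rw [h1, unitValue_coe, ← unitChar_apply, (mem_kerPosUnits.1 hη').2, one_mul]

omit [IsZLattice ℝ (kerLattice χ)] in
/-- **The unit sum along the cosets of `U_𝔣`**: for `ω₀ ≠ 0`, `M > 0` and profiles vanishing on
`(0, ∞)`,
`∑'_{η ∈ U⁺} Ω'(ηω₀)χ(ηω₀) = ∑_{q ∈ U⁺/U_𝔣} χ(r_q ω₀) · ∑'_{η' ∈ U_𝔣} Wcube(logVec(η' r_q ω₀))`,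
`r_q = q.out`. [cite: Mitsui1956, §3] -/
theorem tsum_posUnits_eq_sum_cosets [IsTotallyReal K] [Fintype (posUnits K ⧸ Hsub χ)] {kf : RP → ℝ → ℝ}
    (hhi : ∀ w v, 0 < v → kf w v = 0) {M : ℝ} (hM : 0 < M) {ω₀ : 𝓞 K} (hω₀ : ω₀ ≠ 0) :
    ∑' η : posUnits K, Fsum χ kf M ω₀ η =
      ∑ q : posUnits K ⧸ Hsub χ,
        unitValue χ (Ideal.Quotient.mk 𝔣 ((((q.out : posUnits K) : (𝓞 K)ˣ) : 𝓞 K) * ω₀)) *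
          ∑' η' : kerPosUnits χ, (Wcube K kf M (logVec K ((((η' : (𝓞 K)ˣ) : 𝓞 K) : K) * ((((((q.out : posUnits K) : (𝓞 K)ˣ) : 𝓞 K) * ω₀ : 𝓞 K) : K)))) : ℂ) := by
  -- finite support of the summand, transported along `posUnitsProdEquiv`
  have hfin := finite_support_Fsum χ hhi hM hω₀
  have hsumm : Summable (Fsum χ kf M ω₀) := summable_of_hasFiniteSupport hfin
  have hsumm' : Summable (fun p : (posUnits K ⧸ Hsub χ) × Hsub χ => Fsum χ kf M ω₀ (posUnitsProdEquiv χ p)) :=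
    (Equiv.summable_iff (posUnitsProdEquiv χ)).2 hsumm
  rw [← (posUnitsProdEquiv χ).tsum_eq (Fsum χ kf M ω₀)]
  rw [Summable.tsum_prod' (f := fun p : (posUnits K ⧸ Hsub χ) × Hsub χ => Fsum χ kf M ω₀ (posUnitsProdEquiv χ p)) hsumm'
    (fun q => ?_), tsum_fintype]
  · refine Finset.sum_congr rfl fun q _ => ?_
    -- the inner sum on the coset `q`
    set r : (𝓞 K)ˣ := ((q.out : posUnits K) : (𝓞 K)ˣ) with hr
    have hterm : ∀ η' : Hsub χ, Fsum χ kf M ω₀ (posUnitsProdEquiv χ (q, η')) =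
        (Wcube K kf M (logVec K (((((η' : posUnits K) : (𝓞 K)ˣ) : 𝓞 K) : K) * (((r : 𝓞 K) * ω₀ : 𝓞 K) : K))) : ℂ) *
          unitValue χ (Ideal.Quotient.mk 𝔣 ((r : 𝓞 K) * ω₀)) := by
      intro η'
      unfold Fsum
      rw [posUnitsProdEquiv_apply]
      have hη'mem : (((η' : Hsub χ) : posUnits K) : (𝓞 K)ˣ) ∈ kerPosUnits χ := (mem_Hsub χ).1 η'.2
      -- the element `(q.out * η') ω₀ = η' (r ω₀)`
      have hel : (((q.out * ((η' : Hsub χ) : posUnits K) : posUnits K) : (𝓞 K)ˣ) : 𝓞 K) * ω₀ =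
          ((((η' : Hsub χ) : posUnits K) : (𝓞 K)ˣ) : 𝓞 K) * ((r : 𝓞 K) * ω₀) := by
        rw [hr]; push_cast; ring
      rw [hel, weightΩfam_eq_Wcube', unitValue_mul_of_mem χ hη'mem]
      push_cast
      ring
    rw [tsum_congr hterm, tsum_mul_right, mul_comm]
    congr 1
    -- transport `Hsub χ ≃ kerPosUnits χ`
    have hle : kerPosUnits χ ≤ posUnits K := kerPosUnits_le χ
    rw [← (Subgroup.subgroupOfEquivOfLe hle).toEquiv.tsum_eq]
    rfl
  · -- summability of each slice (finite support)
    exact hsumm'.comp_injective (Prod.mk_right_injective q)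

omit [IsZLattice ℝ (kerLattice χ)] in
/-- **The unit sum as a finite sum of periodizations**:
`∑'_{η ∈ U⁺} Ω'(ηω₀)χ(ηω₀) = ∑_{q ∈ U⁺/U_𝔣} χ(r_q ω₀) · periodize L_𝔣 (Φ_{t_q}) (h_q)`,
`(t_q, h_q) = toTH (logVec (r_q ω₀))`. [cite: Mitsui1956, §3] -/
theorem tsum_posUnits_eq_sum_periodize [IsTotallyReal K] [Fintype (posUnits K ⧸ Hsub χ)] {kf : RP → ℝ → ℝ}
    (hhi : ∀ w v, 0 < v → kf w v = 0) {M : ℝ} (hM : 0 < M) {ω₀ : 𝓞 K} (hω₀ : ω₀ ≠ 0) :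
    ∑' η : posUnits K, Fsum χ kf M ω₀ η =
      ∑ q : posUnits K ⧸ Hsub χ,
        unitValue χ (Ideal.Quotient.mk 𝔣 ((((q.out : posUnits K) : (𝓞 K)ˣ) : 𝓞 K) * ω₀)) *
          (periodize (kerLattice χ) (PhiT K kf M (toTH K (logVec K (((((q.out : posUnits K) : (𝓞 K)ˣ) : 𝓞 K) * ω₀ : 𝓞 K) : K))).1)
            (toTH K (logVec K (((((q.out : posUnits K) : (𝓞 K)ˣ) : 𝓞 K) * ω₀ : 𝓞 K) : K))).2 : ℂ) := by
  rw [tsum_posUnits_eq_sum_cosets χ hhi hM hω₀]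
  refine Finset.sum_congr rfl fun q _ => ?_
  congr 1
  have hα : (((((q.out : posUnits K) : (𝓞 K)ˣ) : 𝓞 K) * ω₀ : 𝓞 K) : K) ≠ 0 := by
    push_cast
    exact mul_ne_zero (by exact_mod_cast ((q.out : posUnits K) : (𝓞 K)ˣ).ne_zero) (by exact_mod_cast hω₀)
  rw [← tsum_kerPosUnits_Wcube χ kf M hα, Complex.ofReal_tsum]

end Literature.NumberTheory.Sieve.ThetaUnits
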